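import Summits.ABC.StewartYu.PadicTwistExistsAnyOrder
import Literature.NumberTheory.Transcendental.PadicLogPrincipalUnits
import HarnessLib

/-!
# Cell abc-stewartyu, WP-Y provider B (xvi): every root of unity of `ℚ_p` (`p` odd) is a power of ONE
# primitive `(p−1)`-th root

`Summits/ABC/StewartYu/PadicTwistPMRoots.lean` — cell `abc-stewartyu`, seat p3 (crux `W80OneModFour`
stmt-ABC-19487). The `p ≡ 1 (mod 4)` half step (`halfStep_pm_of`, PadicTwistPMHalfStep) wants the
twisting roots of unity of an ARBITRARY twisted set-up (as quantified in `TwistCoreBoundPM`) written as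
powers `ηᵢ = ζ^{rᵢ}` of one primitive `(p−1)`-th root of unity `ζ`. This holds for every root of unity of
`ℚ_p`, `p` odd: Teichmüller (`padicInt_exists_norm_mul_pow_sub_one_lt`, lit) gives `r` with `x·ζ^r`
principal, and a principal unit of finite order is `1` (`log_p` is injective on principal units).
[folklore]; no named fact.
-/

noncomputable section

open Literature.NumberTheory.LocalFields
open Literature.NumberTheory.Transcendental

namespace Summit.ABC.StewartYu

namespace TwistExistsAnyOrder

variable {p : ℕ} [Fact p.Prime]

/-- **A principal unit of finite order is `1`** (`‖y − 1‖ ≤ p⁻¹`, `y^N = 1`, `N > 0`, `p ≥ 3`). [folklore] -/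
theorem eq_one_of_pow_eq_one_of_principal (hp3 : 3 ≤ p) {y : ℚ_[p]} (hy : ‖y - 1‖ ≤ (p : ℝ)⁻¹)
    {N : ℕ} (hN : 0 < N) (hyN : y ^ N = 1) : y = 1 := by
  have hp : p.Prime := Fact.out
  have hp1 : (1 : ℝ) < p := by exact_mod_cast hp.one_lt
  have hy' : ‖1 - y‖ ≤ (p : ℝ)⁻¹ := by rwa [norm_sub_rev]
  have hlt : ‖1 - y‖ < 1 := hy'.trans_lt (inv_lt_one_of_one_lt₀ hp1)
  have h1 : PadicExp.plog (y ^ N) = (N : ℚ_[p]) * PadicExp.plog y := PadicExp.plog_pow (ℓ := p) hlt N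
  rw [hyN, PadicExp.plog_one] at h1
  have hN0 : (N : ℚ_[p]) ≠ 0 := by exact_mod_cast hN.ne'
  have hlog : PadicExp.plog y = 0 := by
    rcases mul_eq_zero.mp h1.symm with h | h
    · exact absurd h hN0
    · exact h
  have h2 := PadicExp.exp_plog hp3 hy'
  rw [hlog, NormedSpace.exp_zero] at h2
  exact h2.symm

/-- **Every root of unity of `ℚ_p` (`p` odd) is a power of a primitive `(p−1)`-th root of unity.**
[folklore] -/
theorem exists_pow_eq_of_pow_eq_one (hp3 : 3 ≤ p) {ζ : ℚ_[p]} (hζ1 : ‖ζ‖ = 1)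
    (hζ : IsPrimitiveRoot ζ (p - 1)) {x : ℚ_[p]} {G : ℕ} (hG : 0 < G) (hx : x ^ G = 1) :
    ∃ r : ℕ, r < p - 1 ∧ x = ζ ^ r := by
  have hp : p.Prime := Fact.out
  -- `‖x‖ = 1`
  have hx1 : ‖x‖ = 1 := by
    have h := congrArg (‖·‖) hx
    simp only [norm_pow, norm_one] at h
    exact (pow_eq_one_iff_of_nonneg (norm_nonneg _) hG.ne').mp h
  -- in `ℤ_p`
  set X : ℤ_[p] := ⟨x, hx1.le⟩ with hX
  set Z : ℤ_[p] := ⟨ζ, hζ1.le⟩ with hZ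
  have hinj : Function.Injective (PadicInt.Coe.ringHom (p := p)) := fun a b h => PadicInt.ext h
  have hZprim : IsPrimitiveRoot Z (p - 1) := by
    refine (IsPrimitiveRoot.map_iff_of_injective hinj).mp ?_
    show IsPrimitiveRoot ((Z : ℚ_[p])) (p - 1)
    exact hζ
  have hXn : ‖X‖ = 1 := hx1
  obtain ⟨r, hr, hlt⟩ := padicInt_exists_norm_mul_pow_sub_one_lt hZprim hXn
  -- `y := x ζ^r` is a principal unit of finite order, hence `1`
  have hy : ‖x * ζ ^ r - 1‖ ≤ (p : ℝ)⁻¹ := by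
    refine TwistSetup.norm_sub_one_le_inv_of_lt ?_
    have : ((X * Z ^ r - 1 : ℤ_[p]) : ℚ_[p]) = x * ζ ^ r - 1 := by push_cast; rfl
    rw [← this, ← PadicInt.norm_def]
    exact hlt
  have hp1' : 0 < p - 1 := by omega
  have hyN : (x * ζ ^ r) ^ (G * (p - 1)) = 1 := by
    rw [mul_pow, pow_mul, hx, one_pow, one_mul, ← pow_mul,
      show r * (G * (p - 1)) = (p - 1) * (r * G) by ring, pow_mul, hζ.pow_eq_one, one_pow]
  have hy1 := eq_one_of_pow_eq_one_of_principal hp3 hy (Nat.mul_pos hG hp1') hyN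
  -- `x = ζ^{p−1−r}`
  refine ⟨(p - 1 - r) % (p - 1), Nat.mod_lt _ hp1', ?_⟩
  have hζpow : ζ ^ ((p - 1 - r) % (p - 1)) = ζ ^ (p - 1 - r) := by
    conv_rhs => rw [← Nat.mod_add_div (p - 1 - r) (p - 1), pow_add, pow_mul, hζ.pow_eq_one, one_pow,
      mul_one]
  rw [hζpow]
  have hζ0 : ζ ≠ 0 := hζ.ne_zero (by omega)
  have e : x = x * ζ ^ r * ζ ^ (p - 1 - r) := by
    rw [mul_assoc, ← pow_add, show r + (p - 1 - r) = p - 1 by omega, hζ.pow_eq_one, mul_one]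
  rw [e, hy1, one_mul]

/-- The family version: roots of unity `ηᵢ` (`ηᵢ^G = 1`) are `ζ^{rᵢ}`. [folklore] -/
theorem exists_pows_eq_of_pow_eq_one (hp3 : 3 ≤ p) {ζ : ℚ_[p]} (hζ1 : ‖ζ‖ = 1)
    (hζ : IsPrimitiveRoot ζ (p - 1)) {n G : ℕ} (hG : 0 < G) (η : Fin n → ℚ_[p])
    (hη : ∀ i, η i ^ G = 1) : ∃ r : Fin n → ℕ, ∀ i, r i < p - 1 ∧ η i = ζ ^ r i := by
  have h1 : ∀ i, ∃ ri : ℕ, ri < p - 1 ∧ η i = ζ ^ ri :=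
    fun i => exists_pow_eq_of_pow_eq_one hp3 hζ1 hζ hG (hη i)
  choose r hr using h1
  exact ⟨r, hr⟩

end TwistExistsAnyOrder

end Summit.ABC.StewartYu

end
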